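import Summits.BirchSwinnertonDyer.BirchSwinnertonDyer.Theorems.EdixhovenFibreFiveSevenStarredOptimalManinUnitFiveSevenTowerRangeAt
import Summits.BirchSwinnertonDyer.BirchSwinnertonDyer.Theorems.EdixhovenFibreFiveSevenStarredOptimalManinUnitFiveSevenSemiLocalIntegralityPinAt
import HarnessLib

/-!
# P4-coh and the per-curve Pin, PER CURVE AND PER TOWER (route `EdixhovenFibreFiveSeven`, crux K★ stmt-BirchSwinnertonDyer-22226,
# line `kato-lever`; seat `bsd-line-edix-p1` g29, LEAD)

HONEST FRAMING. TOOL theorems only (no definition, no named fact, no `sorry`; file-local instance keys on `ℚ_v` byte-identical to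
`…SemiLocalIntegrality` / `…SemiLocalIntegralityPinAt`); nothing is closed or booked; BSD / K★ are NOT proved by this. Sequel of
`…TowerRangeAt`. WHY (memo `Lines/kato-lever-K3-H5-endpoint.md` §3 «SEAM», memo `Lines/kato-lever-seam-rec-at-cells.md`): the cite
fact (S5b-tower) — behind it [REC-tower], the stub of skeleton v6 — is consumed by K★ only at the towers `ℚ_v ⊆ ℚ(ζ_m)_w` of ONE
curve; these twins display exactly that instance, so that the K★ closer downstream (`…CellsOfRecTowerAt`) is conditional on the
[REC-tower] BODY at the cells' towers (what the (K₂)^ram road and `…ReciprocityTowerFromAbove` construct), not on the ∀-fields fact.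
* §2 ★★ `expStarOmegaHom_mem_adicCompletionIntegers_of_katoClause_of_rangeAt` — P4-coh (`exp*_{dw}(z) ∈ 𝒪_{w₀}`): the statement of
  `SemiLocalIntegrality.expStarOmegaHom_mem_adicCompletionIntegers_of_katoClause` with `hT₂` replaced by the body of (S5b-tower) at
  `(W, ℚ_v ⊆ L_{w₀})`.
* §3 ★★ `semilocal_mem_adicCompletionIntegers_of_pin_of_semi_of_rangeAt` — the per-curve Pin (`∀ y w, Ψ (Λ y) w ∈ 𝒪_w`): the statement
  of `SemiLocalIntegralityAt.semilocal_mem_adicCompletionIntegers_of_pin_of_semi_of_isDeRhamAt` with `hT₂` replaced by `hT₂w : ∀ w ∣ p`,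
  the body of (S5b-tower) at `(W, ℚ_v ⊆ L_w)`.

References: [Kato1993LNM1553] Ch. II §1.2.4, Prop. 1.2.3, Thm. 1.4.1 (3)–(4); [BlochKato1990] §3 Prop. 3.8, Ex. 3.11;
[KimNakamura2020] Cor. 2.4; [CasselsFrohlichANT1967] Ch. II §10 (10.2); [Kato2004Asterisque] §9.4, Thm. 9.7.
-/

set_option autoImplicit false
-- the Theorems namespace of a single-conjunct summit repeats the summit name by design (D-0017)
set_option linter.dupNamespace false

noncomputable section

open scoped NumberField NNReal Classical TensorProduct
open Field ValuativeRel IsDedekindDomain NumberField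
open Literature.NumberTheory.GaloisRepresentations
open Literature.NumberTheory.GaloisRepresentations.PeriodRingData
open Literature.NumberTheory.PAdicHodge
open Literature.NumberTheory.EllipticCurves WeierstrassCurve
open Literature.NumberTheory.EllipticCurves.FormalGroupChart (padicLogPointFiniteExt
  isIntegral_valuationInteger_of_isIntegral_padicInt)
open Summit.BirchSwinnertonDyer.BirchSwinnertonDyer.Theorems.KimAtThreeDeepLowerExpStarOmega
open Summit.BirchSwinnertonDyer.BirchSwinnertonDyer.Theorems.KimAtThreeDeepLowerExpStarOmegaPlace
open Summit.BirchSwinnertonDyer.BirchSwinnertonDyer.Theorems.KimAtThreeDeepLowerExpStarOmegaRes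
open Summit.BirchSwinnertonDyer.BirchSwinnertonDyer.Theorems.KimAtThreeDeepUpperExpStarTransport
open Summit.BirchSwinnertonDyer.BirchSwinnertonDyer.Theorems.KimAtThreeDeepUpperExpStarFacts
open Summit.BirchSwinnertonDyer.BirchSwinnertonDyer.Theorems.KimAtThreeDeepUpperExpStarFactsCanonical
open Summit.BirchSwinnertonDyer.BirchSwinnertonDyer.Theorems.KimAtThreeDeepUpperExpStarTowerRange
open Summit.BirchSwinnertonDyer.Rank1Residual.GaloisImage
open Rat.HeightOneSpectrum

/-! ## §2 P4-coh per curve / per tower (twin of `SemiLocalIntegrality` §2) -/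

namespace Summit.BirchSwinnertonDyer.BirchSwinnertonDyer.Theorems.StarredOptimalManinUnitFiveSevenSemiLocalIntegralityOfRangeAt

open Literature.NumberTheory.AdelicBaseChange Literature.NumberTheory.Automorphic
open Summit.BirchSwinnertonDyer.BirchSwinnertonDyer.Theorems.KimAtThreeDeepUpperExpStarUnit
open Summit.BirchSwinnertonDyer.BirchSwinnertonDyer.Theorems.KimAtThreeDeepUpperTowerLattice
  (fact_natCast_mem_primesEquiv_symm)
open Summit.BirchSwinnertonDyer.BirchSwinnertonDyer.Theorems.KPort
open Literature.NumberTheory.GaloisRepresentations.LubinTate (unitBall mem_unitBall_iff)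
open Summit.BirchSwinnertonDyer.BirchSwinnertonDyer.Theorems.ReceptacleTorsion
  (norm_le_one_of_forall_point_baseChange_Kw_of_katoClause)
open Summit.BirchSwinnertonDyer.BirchSwinnertonDyer.Theorems.SemiLocalDescent
  (mem_adicCompletionIntegers_of_eq_galAdicCompletionMap)
open Summit.BirchSwinnertonDyer.Rank1Residual.Additive.LocalLog (padicLog)
open Summit.BirchSwinnertonDyer.BirchSwinnertonDyer.Theorems.SemiLocalIntegrality
open Summit.BirchSwinnertonDyer.BirchSwinnertonDyer.Theorems.StarredOptimalManinUnitFiveSevenTowerRangeAt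

variable (p : ℕ) [hp : Fact p.Prime]

-- FILE-LOCAL instance keys, byte-identical to the accepted `…SemiLocalIntegrality.lean` l.126–131 (no library instance is
-- overridden outside this file): the `Fact (p ∈ v_p)` key and the local-field structures on `ℚ_v = Place.Completion (inr v_p)`.
attribute [local instance] fact_natCast_mem_primesEquiv_symm
attribute [local instance 100000] NumberField.Place.instAlgebraCompletion
attribute [local instance] valuativeRelPlace topologicalSpacePlace
attribute [local instance] isNonarchimedeanLocalField_place charZero_place
attribute [local instance] padicAlgebraPlace fact_not_isUnit_place isAdicComplete_place

set_option backward.isDefEq.respectTransparency false in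
set_option maxHeartbeats 800000 in
/-- ★★ **P4-coh PER CURVE / PER TOWER** — `SemiLocalIntegrality.expStarOmegaHom_mem_adicCompletionIntegers_of_katoClause` VERBATIM (`W/ℚ`
globally minimal, `5 ≤ p`, `Addv W p`, an `hdual`-normalised local Néron line `d` at `v_p` with Prop-1.2.3 binders, `p ∤ m`, F″'s clause, a place
`w₀ ∣ p` of `ℚ(ζ_m)`, a (RES_w)-compatible line datum `dw` at `L_{w₀}`), with the ∀-fields cite fact `hT₂` replaced by ONE displayed hypothesis
after (RES_w): the body of (S5b-tower) for THIS curve at THIS tower `ℚ_v ⊆ L_{w₀}` (binder `hT₂W` of `…TowerRangeAt.exists_smul_ranges_of_rangeAt`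
at `L := L_{w₀}`). Conclusion unchanged: `exp*_{dw}(z) ∈ 𝒪_{w₀}`. Proof = the original's, reading (S5b-tower) through `exists_smul_ranges_of_rangeAt`.
CONDITIONAL; nothing is closed. [cite: Kato1993LNM1553, Ch. II §1.2.4, Thm. 1.4.1 (3)–(4)] [cite: BlochKato1990, §3 Prop. 3.8, Ex. 3.11]
[cite: KimNakamura2020, Cor. 2.4] [cite: CasselsFrohlichANT1967, Ch. II §10 Theorem (10.2)] -/
theorem expStarOmegaHom_mem_adicCompletionIntegers_of_katoClause_of_rangeAt
    (W : WeierstrassCurve ℚ) [W.IsElliptic] [W.IsGloballyMinimal] (hp5 : 5 ≤ p)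
    (hadd : Literature.NumberTheory.EllipticCurves.Rank1Residual.Addv W p)
    (d : LocalNeronLineAt W p ((primesEquiv (R := 𝓞 ℚ)).symm ⟨p, hp.out⟩))
    (hinj : (bdRPeriodRingData (valuation_place_lt_one p ((primesEquiv (R := 𝓞 ℚ)).symm ⟨p, hp.out⟩))).CupLogInjective
      (logCyclotomic p) (localRationalTateRep W p (galRestrictPlace ((primesEquiv (R := 𝓞 ℚ)).symm ⟨p, hp.out⟩))))
    (hex : ∀ z : contOneCocycles (localRationalTateRep W p (galRestrictPlace ((primesEquiv (R := 𝓞 ℚ)).symm ⟨p, hp.out⟩))).toTopRep,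
      (bdRPeriodRingData (valuation_place_lt_one p ((primesEquiv (R := 𝓞 ℚ)).symm ⟨p, hp.out⟩))).HasDualExp (logCyclotomic p)
        (localRationalTateRep W p (galRestrictPlace ((primesEquiv (R := 𝓞 ℚ)).symm ⟨p, hp.out⟩))) fun σ => z.1 σ)
    (hdual : ∀ a : ℚ_[p], (∃ y, expStarOmegaPadicAt d hinj hex
        (((Padic.adicCompletionEquiv (𝓞 ℚ) ⟨p, hp.out⟩).symm : (((primesEquiv (R := 𝓞 ℚ)).symm ⟨p, hp.out⟩).adicCompletion ℚ) →+* ℚ_[p])) y = a) ↔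
      ∀ Q : (W.baseChange ℚ_[p]).toAffine.Point, ‖a * padicLog (W.baseChange ℚ_[p]) Q‖ ≤ 1)
    (m : ℕ) [NeZero m] (hpm : ¬ p ∣ m)
    (hcl : 7 < p ∨ (Nat.Coprime (orderOf (p : ZMod m)) (p - 1) ∧
      ∀ P : (W.baseChange ℚ_[p]).toAffine.Point, p • P = 0 → P = 0))
    (w₀ : ((primesEquiv (R := 𝓞 ℚ)).symm ⟨p, hp.out⟩).Extension (𝓞 (CyclotomicField m ℚ))) :
    letI := LocalField.charZero_adicCompletion w₀.1
    letI := LocalField.adicCompletionPadicAlgebra w₀.1 p (Kw.prime_mem_asIdeal w₀)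
    haveI : Fact (¬ IsUnit ((p : ℕ) : integerC (w₀.1.adicCompletion (CyclotomicField m ℚ)))) := ⟨not_isUnit_natCast_integerC (LocalField.valuation_adicCompletion_natCast_lt_one w₀.1 p (Kw.prime_mem_asIdeal w₀))⟩
    haveI := isAdicComplete_integerC_natCast (LocalField.valuation_adicCompletion_natCast_lt_one w₀.1 p (Kw.prime_mem_asIdeal w₀))
    letI : Algebra (Place.Completion (K := ℚ) (Sum.inr ((primesEquiv (R := 𝓞 ℚ)).symm ⟨p, hp.out⟩))) (w₀.1.adicCompletion (CyclotomicField m ℚ)) :=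
      inferInstanceAs (Algebra (((primesEquiv (R := 𝓞 ℚ)).symm ⟨p, hp.out⟩).adicCompletion ℚ) (w₀.1.adicCompletion (CyclotomicField m ℚ)))
    ∀ (dw : LocalNeronLine W (LocalField.valuation_adicCompletion_natCast_lt_one w₀.1 p (Kw.prime_mem_asIdeal w₀)) ((galRestrictPlace ((primesEquiv (R := 𝓞 ℚ)).symm ⟨p, hp.out⟩)).comp (absGaloisRestrict (((primesEquiv (R := 𝓞 ℚ)).symm ⟨p, hp.out⟩).adicCompletion ℚ) (w₀.1.adicCompletion (CyclotomicField m ℚ)))))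
      (hinjw : (bdRPeriodRingData (LocalField.valuation_adicCompletion_natCast_lt_one w₀.1 p (Kw.prime_mem_asIdeal w₀))).CupLogInjective (logCyclotomic p) (localRationalTateRep W p ((galRestrictPlace ((primesEquiv (R := 𝓞 ℚ)).symm ⟨p, hp.out⟩)).comp (absGaloisRestrict (((primesEquiv (R := 𝓞 ℚ)).symm ⟨p, hp.out⟩).adicCompletion ℚ) (w₀.1.adicCompletion (CyclotomicField m ℚ))))))
      (hexw : ∀ z : contOneCocycles (localRationalTateRep W p ((galRestrictPlace ((primesEquiv (R := 𝓞 ℚ)).symm ⟨p, hp.out⟩)).comp (absGaloisRestrict (((primesEquiv (R := 𝓞 ℚ)).symm ⟨p, hp.out⟩).adicCompletion ℚ) (w₀.1.adicCompletion (CyclotomicField m ℚ))))).toTopRep,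
        (bdRPeriodRingData (LocalField.valuation_adicCompletion_natCast_lt_one w₀.1 p (Kw.prime_mem_asIdeal w₀))).HasDualExp (logCyclotomic p) (localRationalTateRep W p ((galRestrictPlace ((primesEquiv (R := 𝓞 ℚ)).symm ⟨p, hp.out⟩)).comp (absGaloisRestrict (((primesEquiv (R := 𝓞 ℚ)).symm ⟨p, hp.out⟩).adicCompletion ℚ) (w₀.1.adicCompletion (CyclotomicField m ℚ))))) fun σ => z.1 σ),
      (∀ h : (tateLocalRep W p (Sum.inr ((primesEquiv (R := 𝓞 ℚ)).symm ⟨p, hp.out⟩))).cohomology 1,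
        expStarOmegaHom (LocalField.valuation_adicCompletion_natCast_lt_one w₀.1 p (Kw.prime_mem_asIdeal w₀)) ((galRestrictPlace ((primesEquiv (R := 𝓞 ℚ)).symm ⟨p, hp.out⟩)).comp (absGaloisRestrict (((primesEquiv (R := 𝓞 ℚ)).symm ⟨p, hp.out⟩).adicCompletion ℚ) (w₀.1.adicCompletion (CyclotomicField m ℚ)))) dw hinjw hexw
          (ContinuousRep.cohomologyRes (tateLocalRep W p (Sum.inr ((primesEquiv (R := 𝓞 ℚ)).symm ⟨p, hp.out⟩))) (absGaloisRestrict (((primesEquiv (R := 𝓞 ℚ)).symm ⟨p, hp.out⟩).adicCompletion ℚ) (w₀.1.adicCompletion (CyclotomicField m ℚ))) 1 h) =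
        algebraMap (((primesEquiv (R := 𝓞 ℚ)).symm ⟨p, hp.out⟩).adicCompletion ℚ) (w₀.1.adicCompletion (CyclotomicField m ℚ)) (expStarOmegaAt d h)) →
      -- (S5b-tower) AT `(W, ℚ_v ⊆ L_{w₀})` ONLY: the body of the cite fact for THIS curve and THIS tower
      (∀ (wv : Valuation (Place.Completion (Sum.inr ((primesEquiv (R := 𝓞 ℚ)).symm ⟨p, hp.out⟩) : Place ℚ)) ℝ≥0) [wv.Compatible]
        [(W.baseChange (Place.Completion (Sum.inr ((primesEquiv (R := 𝓞 ℚ)).symm ⟨p, hp.out⟩) : Place ℚ))).IsIntegral wv.integer]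
        (ν : Valuation (w₀.1.adicCompletion (CyclotomicField m ℚ)) ℝ≥0) [ν.Compatible] [(W.baseChange (w₀.1.adicCompletion (CyclotomicField m ℚ))).IsIntegral ν.integer]
        (d₀ : LocalNeronLineAt W p ((primesEquiv (R := 𝓞 ℚ)).symm ⟨p, hp.out⟩))
        (d : LocalNeronLine W (LocalField.valuation_adicCompletion_natCast_lt_one w₀.1 p (Kw.prime_mem_asIdeal w₀)) ((galRestrictPlace ((primesEquiv (R := 𝓞 ℚ)).symm ⟨p, hp.out⟩)).comp
          (absGaloisRestrict (Place.Completion (Sum.inr ((primesEquiv (R := 𝓞 ℚ)).symm ⟨p, hp.out⟩) : Place ℚ)) (w₀.1.adicCompletion (CyclotomicField m ℚ))))),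
        (bdRPeriodRingData (valuation_place_lt_one p ((primesEquiv (R := 𝓞 ℚ)).symm ⟨p, hp.out⟩))).CupLogInjective (logCyclotomic p)
          (localRationalTateRep W p (galRestrictPlace ((primesEquiv (R := 𝓞 ℚ)).symm ⟨p, hp.out⟩))) →
        (∀ z : contOneCocycles (localRationalTateRep W p (galRestrictPlace ((primesEquiv (R := 𝓞 ℚ)).symm ⟨p, hp.out⟩))).toTopRep,
          (bdRPeriodRingData (valuation_place_lt_one p ((primesEquiv (R := 𝓞 ℚ)).symm ⟨p, hp.out⟩))).HasDualExp (logCyclotomic p)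
            (localRationalTateRep W p (galRestrictPlace ((primesEquiv (R := 𝓞 ℚ)).symm ⟨p, hp.out⟩))) fun σ => z.1 σ) →
        (bdRPeriodRingData (F := (w₀.1.adicCompletion (CyclotomicField m ℚ))) (p := p) (LocalField.valuation_adicCompletion_natCast_lt_one w₀.1 p (Kw.prime_mem_asIdeal w₀))).CupLogInjective (logCyclotomic p)
          (localRationalTateRep W p
            ((galRestrictPlace ((primesEquiv (R := 𝓞 ℚ)).symm ⟨p, hp.out⟩)).comp (absGaloisRestrict (Place.Completion (Sum.inr ((primesEquiv (R := 𝓞 ℚ)).symm ⟨p, hp.out⟩) : Place ℚ)) (w₀.1.adicCompletion (CyclotomicField m ℚ))))) →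
        (∀ z : contOneCocycles (localRationalTateRep W p
            ((galRestrictPlace ((primesEquiv (R := 𝓞 ℚ)).symm ⟨p, hp.out⟩)).comp (absGaloisRestrict (Place.Completion (Sum.inr ((primesEquiv (R := 𝓞 ℚ)).symm ⟨p, hp.out⟩) : Place ℚ)) (w₀.1.adicCompletion (CyclotomicField m ℚ))))).toTopRep,
          (bdRPeriodRingData (F := (w₀.1.adicCompletion (CyclotomicField m ℚ))) (p := p) (LocalField.valuation_adicCompletion_natCast_lt_one w₀.1 p (Kw.prime_mem_asIdeal w₀))).HasDualExp (logCyclotomic p)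
            (localRationalTateRep W p
              ((galRestrictPlace ((primesEquiv (R := 𝓞 ℚ)).symm ⟨p, hp.out⟩)).comp (absGaloisRestrict (Place.Completion (Sum.inr ((primesEquiv (R := 𝓞 ℚ)).symm ⟨p, hp.out⟩) : Place ℚ)) (w₀.1.adicCompletion (CyclotomicField m ℚ)))))
            fun σ => z.1 σ) → (∀ (η₀ : contOneCocycles (restrictedTateRep W (Place.Completion (Sum.inr ((primesEquiv (R := 𝓞 ℚ)).symm ⟨p, hp.out⟩) : Place ℚ)) p).toTopRep)
            (η : contOneCocycles ((restrictedTateRep W (Place.Completion (Sum.inr ((primesEquiv (R := 𝓞 ℚ)).symm ⟨p, hp.out⟩) : Place ℚ)) p).restrict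
              (absGaloisRestrict (Place.Completion (Sum.inr ((primesEquiv (R := 𝓞 ℚ)).symm ⟨p, hp.out⟩) : Place ℚ)) (w₀.1.adicCompletion (CyclotomicField m ℚ)))).toTopRep),
            (∀ σ, η.1 σ = η₀.1 (absGaloisRestrict (Place.Completion (Sum.inr ((primesEquiv (R := 𝓞 ℚ)).symm ⟨p, hp.out⟩) : Place ℚ)) (w₀.1.adicCompletion (CyclotomicField m ℚ)) σ)) →
            expStarCoordTower W (F₀ := (Place.Completion (Sum.inr ((primesEquiv (R := 𝓞 ℚ)).symm ⟨p, hp.out⟩) : Place ℚ))) (LocalField.valuation_adicCompletion_natCast_lt_one w₀.1 p (Kw.prime_mem_asIdeal w₀)) d η =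
              algebraMap (Place.Completion (Sum.inr ((primesEquiv (R := 𝓞 ℚ)).symm ⟨p, hp.out⟩) : Place ℚ)) (w₀.1.adicCompletion (CyclotomicField m ℚ))
                (expStarCoord W (valuation_place_lt_one p ((primesEquiv (R := 𝓞 ℚ)).symm ⟨p, hp.out⟩)) d₀ η₀)) →
        ∃ (e : (Place.Completion (Sum.inr ((primesEquiv (R := 𝓞 ℚ)).symm ⟨p, hp.out⟩) : Place ℚ))) (he : e ≠ 0),
          (∀ a₀ : (Place.Completion (Sum.inr ((primesEquiv (R := 𝓞 ℚ)).symm ⟨p, hp.out⟩) : Place ℚ)),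
            (∃ η₀ : contOneCocycles (restrictedTateRep W (Place.Completion (Sum.inr ((primesEquiv (R := 𝓞 ℚ)).symm ⟨p, hp.out⟩) : Place ℚ)) p).toTopRep,
                expStarCoord W (valuation_place_lt_one p ((primesEquiv (R := 𝓞 ℚ)).symm ⟨p, hp.out⟩)) (d₀.smul e he) η₀ = a₀) ↔
              ∀ P : (W.baseChange (Place.Completion (Sum.inr ((primesEquiv (R := 𝓞 ℚ)).symm ⟨p, hp.out⟩) : Place ℚ))).toAffine.Point,
                ‖Algebra.trace ℚ_[p] (Place.Completion (Sum.inr ((primesEquiv (R := 𝓞 ℚ)).symm ⟨p, hp.out⟩) : Place ℚ)) (a₀ * padicLogPointFiniteExt wv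
                      (W.baseChange (Place.Completion (Sum.inr ((primesEquiv (R := 𝓞 ℚ)).symm ⟨p, hp.out⟩) : Place ℚ))) p P)‖ ≤ 1) ∧ (∀ a : (w₀.1.adicCompletion (CyclotomicField m ℚ)),
            (∃ η : contOneCocycles ((restrictedTateRep W (Place.Completion (Sum.inr ((primesEquiv (R := 𝓞 ℚ)).symm ⟨p, hp.out⟩) : Place ℚ)) p).restrict
                (absGaloisRestrict (Place.Completion (Sum.inr ((primesEquiv (R := 𝓞 ℚ)).symm ⟨p, hp.out⟩) : Place ℚ)) (w₀.1.adicCompletion (CyclotomicField m ℚ)))).toTopRep,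
                expStarCoordTower W (F₀ := (Place.Completion (Sum.inr ((primesEquiv (R := 𝓞 ℚ)).symm ⟨p, hp.out⟩) : Place ℚ))) (LocalField.valuation_adicCompletion_natCast_lt_one w₀.1 p (Kw.prime_mem_asIdeal w₀))
                  (d.smul (algebraMap (Place.Completion (Sum.inr ((primesEquiv (R := 𝓞 ℚ)).symm ⟨p, hp.out⟩) : Place ℚ)) (w₀.1.adicCompletion (CyclotomicField m ℚ)) e)
                    ((map_ne_zero (algebraMap (Place.Completion (Sum.inr ((primesEquiv (R := 𝓞 ℚ)).symm ⟨p, hp.out⟩) : Place ℚ)) (w₀.1.adicCompletion (CyclotomicField m ℚ)))).mpr he)) η = a) ↔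
              ∀ P : (W.baseChange (w₀.1.adicCompletion (CyclotomicField m ℚ))).toAffine.Point,
                ‖Algebra.trace ℚ_[p] (w₀.1.adicCompletion (CyclotomicField m ℚ)) (a * padicLogPointFiniteExt ν (W.baseChange (w₀.1.adicCompletion (CyclotomicField m ℚ))) p P)‖ ≤ 1)) →
      ∀ z, expStarOmegaHom (LocalField.valuation_adicCompletion_natCast_lt_one w₀.1 p (Kw.prime_mem_asIdeal w₀)) ((galRestrictPlace ((primesEquiv (R := 𝓞 ℚ)).symm ⟨p, hp.out⟩)).comp (absGaloisRestrict (((primesEquiv (R := 𝓞 ℚ)).symm ⟨p, hp.out⟩).adicCompletion ℚ) (w₀.1.adicCompletion (CyclotomicField m ℚ)))) dw hinjw hexw z ∈ (w₀.1.adicCompletionIntegers (CyclotomicField m ℚ)) := by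
  intro dw hinjw hexw hres hT₂W z
  letI := LocalField.charZero_adicCompletion w₀.1
  letI := LocalField.adicCompletionPadicAlgebra w₀.1 p (Kw.prime_mem_asIdeal w₀)
  haveI : Fact (¬ IsUnit ((p : ℕ) : integerC (w₀.1.adicCompletion (CyclotomicField m ℚ)))) := ⟨not_isUnit_natCast_integerC (LocalField.valuation_adicCompletion_natCast_lt_one w₀.1 p (Kw.prime_mem_asIdeal w₀))⟩
  haveI := isAdicComplete_integerC_natCast (LocalField.valuation_adicCompletion_natCast_lt_one w₀.1 p (Kw.prime_mem_asIdeal w₀))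
  -- `Place.Completion (inr v₀)` is `ℚ_{v₀}` by `rfl`: read the packet's algebra structure on it
  letI instEF : Algebra (NumberField.Place.Completion (K := ℚ) (Sum.inr ((primesEquiv (R := 𝓞 ℚ)).symm ⟨p, hp.out⟩))) (w₀.1.adicCompletion (CyclotomicField m ℚ)) :=
    inferInstanceAs (Algebra (((primesEquiv (R := 𝓞 ℚ)).symm ⟨p, hp.out⟩).adicCompletion ℚ) (w₀.1.adicCompletion (CyclotomicField m ℚ)))
  -- the compatible `ℝ≥0`-valuation on `L_{w₀}`: the base-`p` norm of the synonym `K_{w₀}` (unramified), and integrality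
  haveI hνc := compatible_normValuation_Kw (p := p) (L := (CyclotomicField m ℚ)) (w := w₀)
  haveI : (W.baseChange (w₀.1.adicCompletion (CyclotomicField m ℚ))).IsIntegral
      ((NormedField.valuation : Valuation (Kw p (CyclotomicField m ℚ) w₀) ℝ≥0).comap
        (Kw.toCompletion p (CyclotomicField m ℚ) w₀).symm.toRingHom).integer :=
    Kw.isIntegral_baseChange_of_isGloballyMinimal _ W
  -- (S5b-tower): ONE rescaling `e`
  obtain ⟨e, he, hde, hrange⟩ := exists_smul_ranges_of_rangeAt W p ((primesEquiv (R := 𝓞 ℚ)).symm ⟨p, hp.out⟩) (LocalField.valuation_adicCompletion_natCast_lt_one w₀.1 p (Kw.prime_mem_asIdeal w₀)) hT₂W d hinj hex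
    ((NormedField.valuation : Valuation (Kw p (CyclotomicField m ℚ) w₀) ℝ≥0).comap (Kw.toCompletion p (CyclotomicField m ℚ) w₀).symm.toRingHom)
    dw hinjw hexw hres (((Padic.adicCompletionEquiv (𝓞 ℚ) ⟨p, hp.out⟩).symm : (((primesEquiv (R := 𝓞 ℚ)).symm ⟨p, hp.out⟩).adicCompletion ℚ) →+* ℚ_[p]))
  -- the unit step: `e ∈ 𝒪_v`
  obtain ⟨heO, -⟩ := mem_integers_of_hdual_smul W p ((primesEquiv (R := 𝓞 ℚ)).symm ⟨p, hp.out⟩) d hinj hex _ hdual he hde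
  have hE0 : algebraMap (((primesEquiv (R := 𝓞 ℚ)).symm ⟨p, hp.out⟩).adicCompletion ℚ) (w₀.1.adicCompletion (CyclotomicField m ℚ)) e ≠ 0 := (map_ne_zero _).mpr he
  have hEO : algebraMap (((primesEquiv (R := 𝓞 ℚ)).symm ⟨p, hp.out⟩).adicCompletion ℚ) (w₀.1.adicCompletion (CyclotomicField m ℚ)) e ∈ (w₀.1.adicCompletionIntegers (CyclotomicField m ℚ)) :=
    w₀.adicCompletionSemialgHom_image_adicCompletionIntegers ℚ (CyclotomicField m ℚ) ⟨e, heO, rfl⟩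
  -- `exp*_{dw} z = E · a'` with `a' := exp*_{E•dw} z` in the trace dual of `log_ω E(L_{w₀})`
  set a' := expStarOmegaHom (LocalField.valuation_adicCompletion_natCast_lt_one w₀.1 p (Kw.prime_mem_asIdeal w₀)) ((galRestrictPlace ((primesEquiv (R := 𝓞 ℚ)).symm ⟨p, hp.out⟩)).comp (absGaloisRestrict (((primesEquiv (R := 𝓞 ℚ)).symm ⟨p, hp.out⟩).adicCompletion ℚ) (w₀.1.adicCompletion (CyclotomicField m ℚ)))) (dw.smul (algebraMap (((primesEquiv (R := 𝓞 ℚ)).symm ⟨p, hp.out⟩).adicCompletion ℚ) (w₀.1.adicCompletion (CyclotomicField m ℚ)) e) ((map_ne_zero (algebraMap (((primesEquiv (R := 𝓞 ℚ)).symm ⟨p, hp.out⟩).adicCompletion ℚ) (w₀.1.adicCompletion (CyclotomicField m ℚ)))).mpr he))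
        hinjw hexw z with ha'_def
  have haa' : expStarOmegaHom (LocalField.valuation_adicCompletion_natCast_lt_one w₀.1 p (Kw.prime_mem_asIdeal w₀)) ((galRestrictPlace ((primesEquiv (R := 𝓞 ℚ)).symm ⟨p, hp.out⟩)).comp (absGaloisRestrict (((primesEquiv (R := 𝓞 ℚ)).symm ⟨p, hp.out⟩).adicCompletion ℚ) (w₀.1.adicCompletion (CyclotomicField m ℚ)))) dw hinjw hexw z = algebraMap (((primesEquiv (R := 𝓞 ℚ)).symm ⟨p, hp.out⟩).adicCompletion ℚ) (w₀.1.adicCompletion (CyclotomicField m ℚ)) e * a' := by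
    rw [ha'_def, expStarOmegaHom_apply, expStarOmegaHom_apply, expStarOmega_smul, ← mul_assoc, mul_inv_cancel₀ hE0, one_mul]
  have hdual' := (hrange a').mp ⟨z, ha'_def.symm⟩
  -- the receptacle exit at `K_{w₀}` (unramified: `p ∤ m`), in (S5b)'s literal currency
  haveI : Fact (w₀.1.asIdeal.ramificationIdx (𝓞 ℚ) = 1) :=
    ⟨Kw.ramificationIdx_eq_one_of_isCyclotomicExtension (p := p) (L := CyclotomicField m ℚ) (w := w₀) m hpm⟩
  letI instQKw : Algebra ℚ (Kw p (CyclotomicField m ℚ) w₀) :=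
    inferInstanceAs (Algebra ℚ (w₀.1.adicCompletion (CyclotomicField m ℚ)))
  haveI : (W.baseChange (Kw p (CyclotomicField m ℚ) w₀)).IsIntegral
      (NormedField.valuation (K := Kw p (CyclotomicField m ℚ) w₀)).integer :=
    Kw.isIntegral_baseChange_of_isGloballyMinimal _ W
  have ha'1 : ‖(Kw.toCompletion p (CyclotomicField m ℚ) w₀).symm a'‖ ≤ 1 := by
    refine norm_le_one_of_forall_point_baseChange_Kw_of_katoClause p (CyclotomicField m ℚ) w₀ W m hpm hp5 hadd hcl
      fun P => ?_
    have h1 := hdual' P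
    rw [Kw.trace_adicCompletionPadicAlgebra_eq w₀ (Kw.prime_mem_asIdeal w₀)] at h1
    rw [Kw.trace_eq]
    exact h1
  have ha'O : a' ∈ w₀.1.adicCompletionIntegers (CyclotomicField m ℚ) :=
    (Kw.mem_unitBall_iff_mem_adicCompletionIntegers _).mp ((mem_unitBall_iff _).mpr ha'1)
  rw [haa']
  exact mul_mem hEO ha'O

/-! ## §3 The per-curve Pin, per tower (twin of `SemiLocalIntegralityPinAt` §2) -/

section Hint
open Summit.BirchSwinnertonDyer.BirchSwinnertonDyer.Theorems.KimAtThreeDeepLowerExpStarOmegaRes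
open Summit.BirchSwinnertonDyer.BirchSwinnertonDyer.Theorems.KimAtThreeDeepUpperExpStarFactsTower
open Summit.BirchSwinnertonDyer.BirchSwinnertonDyer.Theorems.KimAtThreeDeepUpperTowerLattice
  (fact_natCast_mem_primesEquiv_symm)
open Summit.BirchSwinnertonDyer.BirchSwinnertonDyer.Theorems.KimAtThreeFineKatoLevelCompat
  (exists_level_towerCocycle)
open Summit.BirchSwinnertonDyer.BirchSwinnertonDyer.Theorems.KPort
open Literature.NumberTheory.EllipticCurves.Kato2004 Literature.NumberTheory.EllipticCurves.Kato2004.EulerSystemValues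
open Literature.NumberTheory.AdelicBaseChange Literature.NumberTheory.Automorphic

open Summit.BirchSwinnertonDyer.BirchSwinnertonDyer.Theorems.SemiLocalIntegrality
open Summit.BirchSwinnertonDyer.BirchSwinnertonDyer.Theorems.SemiLocalIntegralityAt

set_option backward.isDefEq.respectTransparency false in
set_option maxHeartbeats 1600000 in
/-- ★★ **The per-curve Pin, PER TOWER** — `SemiLocalIntegralityAt.semilocal_mem_adicCompletionIntegers_of_pin_of_semi_of_isDeRhamAt` VERBATIM
(`W/ℚ` globally minimal, `5 ≤ p` additive, de Rham-ness `hDRv` of `V_pW|_{Γ_{ℚ_v}}`, `d₀` with (PIN), `p ∤ m`, F″'s clause, ANY `Λ`, `Ψ`, the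
per-place clause (RES_w) ∧ (DEF_w), Prop. 1.2.3 `hP` displayed), with the ∀-fields cite fact `hT₂` replaced by the displayed `hT₂w`: for every
place `w ∣ p` of `ℚ(ζ_m)`, the body of (S5b-tower) for THIS curve at `ℚ_v ⊆ L_w` (under the packet's own instance terms). Conclusion unchanged:
`∀ y w, Ψ (Λ y) w ∈ 𝒪_w`. Proof = the original's with P4-coh read through `expStarOmegaHom_mem_adicCompletionIntegers_of_katoClause_of_rangeAt`.
CONDITIONAL; nothing is closed. [cite: Kato2004Asterisque, §9.4 (p. 188), Thm. 9.7 (p. 189)] [cite: Kato1993LNM1553, Ch. II Prop. 1.2.3, Thm. 1.4.1 (3)–(4)]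
[cite: BlochKato1990, §3 Prop. 3.8, Ex. 3.11] [cite: KimNakamura2020, Cor. 2.4] [cite: CasselsFrohlichANT1967, Ch. II §10 Theorem (10.2)] -/
theorem semilocal_mem_adicCompletionIntegers_of_pin_of_semi_of_rangeAt
    (hP : cupLogInjective_and_hasDualExp_of_isDeRham)
    (W : WeierstrassCurve ℚ) [W.IsElliptic] [W.IsGloballyMinimal]
    [ContinuousSMul ℤ_[p] (W.tateModule p)] [Module.Free ℤ_[p] (W.tateModule p)]
    [Module.Finite ℤ_[p] (W.tateModule p)]
    (hDRv : GaloisRep.IsDeRham (bdRPeriodRingData (valuation_place_lt_one p ((primesEquiv (R := 𝓞 ℚ)).symm ⟨p, hp.out⟩)))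
      (localRationalTateRep W p (galRestrictPlace ((primesEquiv (R := 𝓞 ℚ)).symm ⟨p, hp.out⟩))))
    (hp5 : 5 ≤ p) (hadd : Literature.NumberTheory.EllipticCurves.Rank1Residual.Addv W p)
    (d₀ : LocalNeronLineAt W p ((primesEquiv (R := 𝓞 ℚ)).symm ⟨p, hp.out⟩))
    (hPIN : ∀ (wv : Valuation (Place.Completion (Sum.inr ((primesEquiv (R := 𝓞 ℚ)).symm ⟨p, hp.out⟩) : Place ℚ)) ℝ≥0) [wv.Compatible]
        [(W.baseChange (Place.Completion (Sum.inr ((primesEquiv (R := 𝓞 ℚ)).symm ⟨p, hp.out⟩) : Place ℚ))).IsIntegral wv.integer],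
      ∀ a : Place.Completion (Sum.inr ((primesEquiv (R := 𝓞 ℚ)).symm ⟨p, hp.out⟩) : Place ℚ),
        (∃ η : contOneCocycles (restrictedTateRep W (Place.Completion (Sum.inr ((primesEquiv (R := 𝓞 ℚ)).symm ⟨p, hp.out⟩) : Place ℚ)) p).toTopRep,
            expStarCoord W (valuation_place_lt_one p ((primesEquiv (R := 𝓞 ℚ)).symm ⟨p, hp.out⟩)) d₀ η = a) ↔
          ∀ P : (W.baseChange (Place.Completion (Sum.inr ((primesEquiv (R := 𝓞 ℚ)).symm ⟨p, hp.out⟩) : Place ℚ))).toAffine.Point,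
            ‖Algebra.trace ℚ_[p] (Place.Completion (Sum.inr ((primesEquiv (R := 𝓞 ℚ)).symm ⟨p, hp.out⟩) : Place ℚ))
                (a * padicLogPointFiniteExt wv (W.baseChange (Place.Completion (Sum.inr ((primesEquiv (R := 𝓞 ℚ)).symm ⟨p, hp.out⟩) : Place ℚ))) p P)‖ ≤ 1)
    (m : ℕ) [NeZero m] (hpm : ¬ p ∣ m)
    (hcl : 7 < p ∨ (Nat.Coprime (orderOf (p : ZMod m)) (p - 1) ∧
      ∀ P : (W.baseChange ℚ_[p]).toAffine.Point, p • P = 0 → P = 0))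
    (Λ : H1 (tateRep W p) (rootsOfUnityFixer ℚ m) →ₗ[ℤ_[p]] ℚ_[p] ⊗[ℚ] CyclotomicField m ℚ)
    (Ψ : ℚ_[p] ⊗[ℚ] CyclotomicField m ℚ ≃ₐ[ℚ]
      (Π w : ((primesEquiv (R := 𝓞 ℚ)).symm ⟨p, hp.out⟩).Extension (𝓞 (CyclotomicField m ℚ)),
        w.1.adicCompletion (CyclotomicField m ℚ)))
    (hSEMI : ∀ (w : ((primesEquiv (R := 𝓞 ℚ)).symm ⟨p, hp.out⟩).Extension (𝓞 (CyclotomicField m ℚ))),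
      ∀ (hw : ((p : ℕ) : 𝓞 (CyclotomicField m ℚ)) ∈ w.1.asIdeal)
        [CharZero (w.1.adicCompletion (CyclotomicField m ℚ))]
        [Fact (¬ IsUnit ((p : ℕ) : integerC (w.1.adicCompletion (CyclotomicField m ℚ))))]
        [IsAdicComplete (Ideal.span {((p : ℕ) : integerC (w.1.adicCompletion (CyclotomicField m ℚ)))}) (integerC (w.1.adicCompletion (CyclotomicField m ℚ)))]
        (hL : valuation (w.1.adicCompletion (CyclotomicField m ℚ)) ((p : ℕ) : (w.1.adicCompletion (CyclotomicField m ℚ))) < 1),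
      letI := LocalField.adicCompletionPadicAlgebra w.1 p hw
      letI ρVT := (W.rationalTateGaloisRep p (W.continuous_rationalGaloisRepTate_holds p)).restrict
        ((absGaloisRestrict ℚ (Place.Completion (Sum.inr ((primesEquiv (R := 𝓞 ℚ)).symm ⟨p, hp.out⟩) : Place ℚ))).comp
          (absGaloisRestrict (((primesEquiv (R := 𝓞 ℚ)).symm ⟨p, hp.out⟩).adicCompletion ℚ) (w.1.adicCompletion (CyclotomicField m ℚ))))
      ∃ (dw : (bdRPeriodRingData hL).FilZeroLine ρVT),
        (∀ (η₀ : contOneCocycles (restrictedTateRep W (Place.Completion (Sum.inr ((primesEquiv (R := 𝓞 ℚ)).symm ⟨p, hp.out⟩) : Place ℚ)) p).toTopRep)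
          (η : contOneCocycles ((restrictedTateRep W (Place.Completion (Sum.inr ((primesEquiv (R := 𝓞 ℚ)).symm ⟨p, hp.out⟩) : Place ℚ)) p).restrict
            (absGaloisRestrict (((primesEquiv (R := 𝓞 ℚ)).symm ⟨p, hp.out⟩).adicCompletion ℚ) (w.1.adicCompletion (CyclotomicField m ℚ)))).toTopRep),
          (∀ σ, η.1 σ = η₀.1 (absGaloisRestrict (((primesEquiv (R := 𝓞 ℚ)).symm ⟨p, hp.out⟩).adicCompletion ℚ) (w.1.adicCompletion (CyclotomicField m ℚ)) σ)) →
          (bdRPeriodRingData hL).dualExpCoord (logCyclotomic p) ρVT dw.ω (fun σ => TateModule.toRational p (η.1 σ)) =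
            algebraMap (((primesEquiv (R := 𝓞 ℚ)).symm ⟨p, hp.out⟩).adicCompletion ℚ) (w.1.adicCompletion (CyclotomicField m ℚ))
              (expStarCoord W (valuation_place_lt_one p ((primesEquiv (R := 𝓞 ℚ)).symm ⟨p, hp.out⟩)) d₀ η₀ :
                Place.Completion (Sum.inr ((primesEquiv (R := 𝓞 ℚ)).symm ⟨p, hp.out⟩) : Place ℚ))) ∧
        (∀ (y : H1 (tateRep W p) (rootsOfUnityFixer ℚ m))
          (φ'' : contOneCocycles (subgroupRep (tateRep W p).toTopRep (rootsOfUnityFixer ℚ m)))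
          (ψT : contOneCocycles ((restrictedTateRep W (Place.Completion (Sum.inr ((primesEquiv (R := 𝓞 ℚ)).symm ⟨p, hp.out⟩) : Place ℚ)) p).restrict
            (absGaloisRestrict (((primesEquiv (R := 𝓞 ℚ)).symm ⟨p, hp.out⟩).adicCompletion ℚ) (w.1.adicCompletion (CyclotomicField m ℚ)))).toTopRep),
          oneCocycleClass _ φ'' = y →
          (∀ σ (hσ : absGaloisRestrictTower ℚ (((primesEquiv (R := 𝓞 ℚ)).symm ⟨p, hp.out⟩).adicCompletion ℚ) (w.1.adicCompletion (CyclotomicField m ℚ)) σ ∈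
              rootsOfUnityFixer ℚ m),
            ψT.1 σ = φ''.1 ⟨absGaloisRestrictTower ℚ (((primesEquiv (R := 𝓞 ℚ)).symm ⟨p, hp.out⟩).adicCompletion ℚ) (w.1.adicCompletion (CyclotomicField m ℚ)) σ, hσ⟩) →
          Ψ (Λ y) w =
            (bdRPeriodRingData hL).dualExpCoord (logCyclotomic p) ρVT dw.ω (fun σ => TateModule.toRational p (ψT.1 σ))))
    -- (S5b-tower) AT `(W, ℚ_v ⊆ L_w)` for every `w ∣ p` of `ℚ(ζ_m)`: the body of the cite fact for THIS curve at THESE towers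
    (hT₂w : ∀ (w : ((primesEquiv (R := 𝓞 ℚ)).symm ⟨p, hp.out⟩).Extension (𝓞 (CyclotomicField m ℚ))), ∀ (hw : ((p : ℕ) : 𝓞 (CyclotomicField m ℚ)) ∈ w.1.asIdeal)
        [CharZero (w.1.adicCompletion (CyclotomicField m ℚ))] [Fact (¬ IsUnit ((p : ℕ) : integerC (w.1.adicCompletion (CyclotomicField m ℚ))))]
        [IsAdicComplete (Ideal.span {((p : ℕ) : integerC (w.1.adicCompletion (CyclotomicField m ℚ)))}) (integerC (w.1.adicCompletion (CyclotomicField m ℚ)))]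
        (hL : valuation (w.1.adicCompletion (CyclotomicField m ℚ)) ((p : ℕ) : (w.1.adicCompletion (CyclotomicField m ℚ))) < 1), letI := LocalField.adicCompletionPadicAlgebra w.1 p hw
      letI : Algebra (Place.Completion (K := ℚ) (Sum.inr ((primesEquiv (R := 𝓞 ℚ)).symm ⟨p, hp.out⟩))) (w.1.adicCompletion (CyclotomicField m ℚ)) :=
        inferInstanceAs (Algebra (((primesEquiv (R := 𝓞 ℚ)).symm ⟨p, hp.out⟩).adicCompletion ℚ) (w.1.adicCompletion (CyclotomicField m ℚ)))
      ∀ (wv : Valuation (Place.Completion (Sum.inr ((primesEquiv (R := 𝓞 ℚ)).symm ⟨p, hp.out⟩) : Place ℚ)) ℝ≥0) [wv.Compatible]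
          [(W.baseChange (Place.Completion (Sum.inr ((primesEquiv (R := 𝓞 ℚ)).symm ⟨p, hp.out⟩) : Place ℚ))).IsIntegral wv.integer]
          (ν : Valuation (w.1.adicCompletion (CyclotomicField m ℚ)) ℝ≥0) [ν.Compatible] [(W.baseChange (w.1.adicCompletion (CyclotomicField m ℚ))).IsIntegral ν.integer]
          (d₀ : LocalNeronLineAt W p ((primesEquiv (R := 𝓞 ℚ)).symm ⟨p, hp.out⟩)) (d : LocalNeronLine W hL ((galRestrictPlace ((primesEquiv (R := 𝓞 ℚ)).symm ⟨p, hp.out⟩)).comp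
            (absGaloisRestrict (Place.Completion (Sum.inr ((primesEquiv (R := 𝓞 ℚ)).symm ⟨p, hp.out⟩) : Place ℚ)) (w.1.adicCompletion (CyclotomicField m ℚ))))),
          (bdRPeriodRingData (valuation_place_lt_one p ((primesEquiv (R := 𝓞 ℚ)).symm ⟨p, hp.out⟩))).CupLogInjective (logCyclotomic p)
            (localRationalTateRep W p (galRestrictPlace ((primesEquiv (R := 𝓞 ℚ)).symm ⟨p, hp.out⟩))) →
          (∀ z : contOneCocycles (localRationalTateRep W p (galRestrictPlace ((primesEquiv (R := 𝓞 ℚ)).symm ⟨p, hp.out⟩))).toTopRep,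
            (bdRPeriodRingData (valuation_place_lt_one p ((primesEquiv (R := 𝓞 ℚ)).symm ⟨p, hp.out⟩))).HasDualExp (logCyclotomic p)
              (localRationalTateRep W p (galRestrictPlace ((primesEquiv (R := 𝓞 ℚ)).symm ⟨p, hp.out⟩))) fun σ => z.1 σ) →
          (bdRPeriodRingData (F := (w.1.adicCompletion (CyclotomicField m ℚ))) (p := p) hL).CupLogInjective (logCyclotomic p) (localRationalTateRep W p
              ((galRestrictPlace ((primesEquiv (R := 𝓞 ℚ)).symm ⟨p, hp.out⟩)).comp (absGaloisRestrict (Place.Completion (Sum.inr ((primesEquiv (R := 𝓞 ℚ)).symm ⟨p, hp.out⟩) : Place ℚ)) (w.1.adicCompletion (CyclotomicField m ℚ))))) →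
          (∀ z : contOneCocycles (localRationalTateRep W p
              ((galRestrictPlace ((primesEquiv (R := 𝓞 ℚ)).symm ⟨p, hp.out⟩)).comp (absGaloisRestrict (Place.Completion (Sum.inr ((primesEquiv (R := 𝓞 ℚ)).symm ⟨p, hp.out⟩) : Place ℚ)) (w.1.adicCompletion (CyclotomicField m ℚ))))).toTopRep,
            (bdRPeriodRingData (F := (w.1.adicCompletion (CyclotomicField m ℚ))) (p := p) hL).HasDualExp (logCyclotomic p) (localRationalTateRep W p
                ((galRestrictPlace ((primesEquiv (R := 𝓞 ℚ)).symm ⟨p, hp.out⟩)).comp (absGaloisRestrict (Place.Completion (Sum.inr ((primesEquiv (R := 𝓞 ℚ)).symm ⟨p, hp.out⟩) : Place ℚ)) (w.1.adicCompletion (CyclotomicField m ℚ)))))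
              fun σ => z.1 σ) → (∀ (η₀ : contOneCocycles (restrictedTateRep W (Place.Completion (Sum.inr ((primesEquiv (R := 𝓞 ℚ)).symm ⟨p, hp.out⟩) : Place ℚ)) p).toTopRep)
              (η : contOneCocycles ((restrictedTateRep W (Place.Completion (Sum.inr ((primesEquiv (R := 𝓞 ℚ)).symm ⟨p, hp.out⟩) : Place ℚ)) p).restrict
                (absGaloisRestrict (Place.Completion (Sum.inr ((primesEquiv (R := 𝓞 ℚ)).symm ⟨p, hp.out⟩) : Place ℚ)) (w.1.adicCompletion (CyclotomicField m ℚ)))).toTopRep),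
              (∀ σ, η.1 σ = η₀.1 (absGaloisRestrict (Place.Completion (Sum.inr ((primesEquiv (R := 𝓞 ℚ)).symm ⟨p, hp.out⟩) : Place ℚ)) (w.1.adicCompletion (CyclotomicField m ℚ)) σ)) →
              expStarCoordTower W (F₀ := (Place.Completion (Sum.inr ((primesEquiv (R := 𝓞 ℚ)).symm ⟨p, hp.out⟩) : Place ℚ))) hL d η =
                algebraMap (Place.Completion (Sum.inr ((primesEquiv (R := 𝓞 ℚ)).symm ⟨p, hp.out⟩) : Place ℚ)) (w.1.adicCompletion (CyclotomicField m ℚ))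
                  (expStarCoord W (valuation_place_lt_one p ((primesEquiv (R := 𝓞 ℚ)).symm ⟨p, hp.out⟩)) d₀ η₀)) →
          ∃ (e : (Place.Completion (Sum.inr ((primesEquiv (R := 𝓞 ℚ)).symm ⟨p, hp.out⟩) : Place ℚ))) (he : e ≠ 0),
            (∀ a₀ : (Place.Completion (Sum.inr ((primesEquiv (R := 𝓞 ℚ)).symm ⟨p, hp.out⟩) : Place ℚ)),
              (∃ η₀ : contOneCocycles (restrictedTateRep W (Place.Completion (Sum.inr ((primesEquiv (R := 𝓞 ℚ)).symm ⟨p, hp.out⟩) : Place ℚ)) p).toTopRep,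
                  expStarCoord W (valuation_place_lt_one p ((primesEquiv (R := 𝓞 ℚ)).symm ⟨p, hp.out⟩)) (d₀.smul e he) η₀ = a₀) ↔
                ∀ P : (W.baseChange (Place.Completion (Sum.inr ((primesEquiv (R := 𝓞 ℚ)).symm ⟨p, hp.out⟩) : Place ℚ))).toAffine.Point,
                  ‖Algebra.trace ℚ_[p] (Place.Completion (Sum.inr ((primesEquiv (R := 𝓞 ℚ)).symm ⟨p, hp.out⟩) : Place ℚ)) (a₀ * padicLogPointFiniteExt wv
                        (W.baseChange (Place.Completion (Sum.inr ((primesEquiv (R := 𝓞 ℚ)).symm ⟨p, hp.out⟩) : Place ℚ))) p P)‖ ≤ 1) ∧ (∀ a : (w.1.adicCompletion (CyclotomicField m ℚ)),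
              (∃ η : contOneCocycles ((restrictedTateRep W (Place.Completion (Sum.inr ((primesEquiv (R := 𝓞 ℚ)).symm ⟨p, hp.out⟩) : Place ℚ)) p).restrict
                  (absGaloisRestrict (Place.Completion (Sum.inr ((primesEquiv (R := 𝓞 ℚ)).symm ⟨p, hp.out⟩) : Place ℚ)) (w.1.adicCompletion (CyclotomicField m ℚ)))).toTopRep,
                  expStarCoordTower W (F₀ := (Place.Completion (Sum.inr ((primesEquiv (R := 𝓞 ℚ)).symm ⟨p, hp.out⟩) : Place ℚ))) hL
                    (d.smul (algebraMap (Place.Completion (Sum.inr ((primesEquiv (R := 𝓞 ℚ)).symm ⟨p, hp.out⟩) : Place ℚ)) (w.1.adicCompletion (CyclotomicField m ℚ)) e)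
                      ((map_ne_zero (algebraMap (Place.Completion (Sum.inr ((primesEquiv (R := 𝓞 ℚ)).symm ⟨p, hp.out⟩) : Place ℚ)) (w.1.adicCompletion (CyclotomicField m ℚ)))).mpr he)) η = a) ↔
                ∀ P : (W.baseChange (w.1.adicCompletion (CyclotomicField m ℚ))).toAffine.Point,
                  ‖Algebra.trace ℚ_[p] (w.1.adicCompletion (CyclotomicField m ℚ)) (a * padicLogPointFiniteExt ν (W.baseChange (w.1.adicCompletion (CyclotomicField m ℚ))) p P)‖ ≤ 1)) :
    ∀ (y : H1 (tateRep W p) (rootsOfUnityFixer ℚ m))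
      (w : ((primesEquiv (R := 𝓞 ℚ)).symm ⟨p, hp.out⟩).Extension (𝓞 (CyclotomicField m ℚ))),
      Ψ (Λ y) w ∈ w.1.adicCompletionIntegers (CyclotomicField m ℚ) := by
  intro y w
  -- local-field structures at `L_w`, instantiated with the packet's own terms (as the P1 draft prescribes)
  have hw : ((p : ℕ) : 𝓞 (CyclotomicField m ℚ)) ∈ w.1.asIdeal := Kw.prime_mem_asIdeal w
  letI := LocalField.charZero_adicCompletion w.1
  letI := LocalField.adicCompletionPadicAlgebra w.1 p hw
  haveI : Fact (¬ IsUnit ((p : ℕ) : integerC (w.1.adicCompletion (CyclotomicField m ℚ)))) :=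
    ⟨not_isUnit_natCast_integerC (LocalField.valuation_adicCompletion_natCast_lt_one w.1 p hw)⟩
  haveI := isAdicComplete_integerC_natCast (LocalField.valuation_adicCompletion_natCast_lt_one w.1 p hw)
  -- `Place.Completion (inr v)` is `ℚ_v` by `rfl`: read the packet's algebra structure on it
  letI instEF : Algebra (Place.Completion (K := ℚ) (Sum.inr ((primesEquiv (R := 𝓞 ℚ)).symm ⟨p, hp.out⟩)))
      (w.1.adicCompletion (CyclotomicField m ℚ)) :=
    inferInstanceAs (Algebra (((primesEquiv (R := 𝓞 ℚ)).symm ⟨p, hp.out⟩).adicCompletion ℚ)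
      (w.1.adicCompletion (CyclotomicField m ℚ)))
  have hcont : Continuous (algebraMap (Place.Completion (K := ℚ) (Sum.inr ((primesEquiv (R := 𝓞 ℚ)).symm ⟨p, hp.out⟩)))
      (w.1.adicCompletion (CyclotomicField m ℚ))) :=
    w.adicCompletionSemialgHom_continuous ℚ (CyclotomicField m ℚ)
  -- the per-place clause of the datum at `w`
  obtain ⟨dw, hres, hdef⟩ := hSEMI w hw (LocalField.valuation_adicCompletion_natCast_lt_one w.1 p hw)
  -- Kato's Prop. 1.2.3 binders at the base and at `L_w` (cite fact `hP`, per-curve de Rham hypothesis `hDRv`)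
  obtain ⟨hinj, hex⟩ := hinj_hex_of_isDeRhamAt W p ((primesEquiv (R := 𝓞 ℚ)).symm ⟨p, hp.out⟩) hP hDRv
  haveI : Module.Finite ℚ_[p] (W.rationalTateModule p) := WeierstrassCurve.module_finite_rationalTateModule_holds W p
  have hDRw := isDeRham_localRationalTateRep_comp_of_isDeRhamAt W p ((primesEquiv (R := 𝓞 ℚ)).symm ⟨p, hp.out⟩)
    (LocalField.valuation_adicCompletion_natCast_lt_one w.1 p hw) hDRv hcont
  obtain ⟨hinjw, hexw⟩ := hP (LocalField.valuation_adicCompletion_natCast_lt_one w.1 p hw)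
    (localRationalTateRep W p ((galRestrictPlace ((primesEquiv (R := 𝓞 ℚ)).symm ⟨p, hp.out⟩)).comp
      (absGaloisRestrict (((primesEquiv (R := 𝓞 ℚ)).symm ⟨p, hp.out⟩).adicCompletion ℚ) (w.1.adicCompletion (CyclotomicField m ℚ))))) hDRw
  -- the PIN in W2's `hdual` shape
  have hdual := hdual_of_pin W p ((primesEquiv (R := 𝓞 ℚ)).symm ⟨p, hp.out⟩) d₀ hinj hex hPIN
    (((Padic.adicCompletionEquiv (𝓞 ℚ) ⟨p, hp.out⟩).symm : (((primesEquiv (R := 𝓞 ℚ)).symm ⟨p, hp.out⟩).adicCompletion ℚ) →+* ℚ_[p]))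
  -- (RES_w) on classes from the cocycle-level clause
  have hres' : ∀ h : (tateLocalRep W p (Sum.inr ((primesEquiv (R := 𝓞 ℚ)).symm ⟨p, hp.out⟩))).cohomology 1,
      expStarOmegaHom (LocalField.valuation_adicCompletion_natCast_lt_one w.1 p hw) ((galRestrictPlace ((primesEquiv (R := 𝓞 ℚ)).symm ⟨p, hp.out⟩)).comp (absGaloisRestrict (((primesEquiv (R := 𝓞 ℚ)).symm ⟨p, hp.out⟩).adicCompletion ℚ) (w.1.adicCompletion (CyclotomicField m ℚ)))) dw hinjw hexw
          (ContinuousRep.cohomologyRes (tateLocalRep W p (Sum.inr ((primesEquiv (R := 𝓞 ℚ)).symm ⟨p, hp.out⟩))) (absGaloisRestrict (((primesEquiv (R := 𝓞 ℚ)).symm ⟨p, hp.out⟩).adicCompletion ℚ) (w.1.adicCompletion (CyclotomicField m ℚ))) 1 h) =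
        algebraMap (((primesEquiv (R := 𝓞 ℚ)).symm ⟨p, hp.out⟩).adicCompletion ℚ) (w.1.adicCompletion (CyclotomicField m ℚ)) (expStarOmegaAt d₀ h) := by
    intro h
    obtain ⟨η₀, rfl⟩ := oneCocycleClass_surjective _ h
    let ηp := contOneCocycles.pullback (absGaloisRestrict (((primesEquiv (R := 𝓞 ℚ)).symm ⟨p, hp.out⟩).adicCompletion ℚ) (w.1.adicCompletion (CyclotomicField m ℚ)))
      (Y := ((tateLocalRep W p (Sum.inr ((primesEquiv (R := 𝓞 ℚ)).symm ⟨p, hp.out⟩))).restrict (absGaloisRestrict (((primesEquiv (R := 𝓞 ℚ)).symm ⟨p, hp.out⟩).adicCompletion ℚ) (w.1.adicCompletion (CyclotomicField m ℚ)))).toTopRep)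
      (TopRep.ofHom ⟨ContinuousLinearMap.id ℤ (W.tateModule p), fun _ => rfl⟩) η₀
    have hcl' : (tateLocalRep W p (Sum.inr ((primesEquiv (R := 𝓞 ℚ)).symm ⟨p, hp.out⟩))).cohomologyRes (absGaloisRestrict (((primesEquiv (R := 𝓞 ℚ)).symm ⟨p, hp.out⟩).adicCompletion ℚ) (w.1.adicCompletion (CyclotomicField m ℚ))) 1
        (oneCocycleClass _ η₀) =
        oneCocycleClass (localTateRep W p ((galRestrictPlace ((primesEquiv (R := 𝓞 ℚ)).symm ⟨p, hp.out⟩)).comp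
          (absGaloisRestrict (((primesEquiv (R := 𝓞 ℚ)).symm ⟨p, hp.out⟩).adicCompletion ℚ) (w.1.adicCompletion (CyclotomicField m ℚ))))).toTopRep ηp :=
      KimAtThreeDeepLowerExpStarOmegaRes.cohomologyRes_oneCocycleClass _ _ η₀
    rw [hcl', expStarOmegaHom_apply, expStarOmega_oneCocycleClass, expStarOmegaAt_eq_expStarCoord]
    exact hres η₀ ηp fun σ => pullback_id_apply _ _ η₀ σ
  -- P4-coh part 1: the defined `exp*` of the tower representation at `L_w` is integral
  have hint := StarredOptimalManinUnitFiveSevenSemiLocalIntegralityOfRangeAt.expStarOmegaHom_mem_adicCompletionIntegers_of_katoClause_of_rangeAt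
    p W hp5 hadd d₀ hinj hex hdual m hpm hcl w dw hinjw hexw hres'
    (hT₂w w hw (LocalField.valuation_adicCompletion_natCast_lt_one w.1 p hw))
  -- a cocycle of `y` and its tower cocycle (membership by §1 of part 2)
  obtain ⟨φ'', hφ⟩ := oneCocycleClass_surjective _ y
  obtain ⟨ψT, hψT⟩ := exists_level_towerCocycle W p ((primesEquiv (R := 𝓞 ℚ)).symm ⟨p, hp.out⟩)
    (w.1.adicCompletion (CyclotomicField m ℚ)) (rootsOfUnityFixer ℚ m)
    (fun σ => absGaloisRestrictTower_adicCompletion_mem_rootsOfUnityFixer p m w σ) φ''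
  have hΨ := hdef y φ'' ψT hφ (fun σ _ => hψT σ)
  rw [hΨ]
  have key := hint (oneCocycleClass _ ψT)
  rw [expStarOmegaHom_apply, expStarOmega_oneCocycleClass] at key
  exact key

end Hint

end Summit.BirchSwinnertonDyer.BirchSwinnertonDyer.Theorems.StarredOptimalManinUnitFiveSevenSemiLocalIntegralityOfRangeAt

end
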